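import Literature.AnabelianGeometry.Anabelioids.ObjectsFromActions
import Literature.AnabelianGeometry.Anabelioids.ConnectedOfTransitive
import Mathlib.CategoryTheory.Galois.Prorepresentability
import Mathlib.Data.Countable.Small
import Mathlib.Tactic.Group
import HarnessLib

/-!
# Galois objects of a connected anabelioid with PRESCRIBED (open normal) stabiliser

Grothendieck's Galois theory [SGA1, Exp. V §4–5] as used in Mochizuki, *The geometry of anabelioids*,
Publ. RIMS **40** (2004), §1.1 p. 10, and *Semi-graphs of anabelioids*, Publ. RIMS **42** (2006), §3 p. 38
("Let `{G_i → G}_{i ∈ I}` be some cofinal collection of connected finite étale Galois coverings … `π̂₁(G)`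
may be constructed as the inverse limit `lim Gal(G_i/G)`") [cite: MochizukiGeoAn2004, §1.1 p.10].

Proof-only file (no definitions; seat abc-iut-L3-t9, E1 junction (J2b) of the abc-iut cell's row T54-B:
the CHARACTERISTIC Galois tower wants Galois objects realising PRESCRIBED open normal subgroups of
`π̂₁ = Aut F`, e.g. abc-iut-w4-d053/w4-d048's characteristic open cores).  For a Galois category `C` with
fibre functor `F`:

* `exists_hom_map_eq_of_equivariant` — an `Aut F`-equivariant map of fibres is `F` of a morphism;
* (an object whose fibre is a nonempty TRANSITIVE `Aut F`-set is connected: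
  `isConnected_of_isPretransitive`, `ConnectedOfTransitive.lean`);
* `exists_aut_map_eq_of_equivariant_perm` — an equivariant PERMUTATION of the fibre is `F` of an
  automorphism; hence `isGalois_of_equivariant_perms`;
* `exists_isGalois_stabilizer_eq` — for every open NORMAL subgroup `V ≤ Aut F` there is a GALOIS object
  `A` with a point `a ∈ F(A)` whose stabiliser is exactly `V` (the finite `Aut F`-set `Aut F ⧸ V`, shrunk
  into the fibre universe, is the fibre of an object by `exists_obj_of_aut_action`; it is connected, and
  the right translations of `Aut F ⧸ V` — equivariant since `V` is normal — lift to a transitive group of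
  automorphisms);
* `exists_hom_of_stabilizer_le` — for `A` connected with `a ∈ F(A)` and `b ∈ F(B)` with
  `Stab(a) ≤ Stab(b)`, a morphism `A ⟶ B` with `a ↦ b`: the transition maps of a tower with prescribed
  antitone stabilisers.

Nothing here refers to the IUT corpus or takes a side on [IUTchIII] Cor 3.12.
-/

namespace Literature.AnabelianGeometry.Anabelioids

open CategoryTheory CategoryTheory.PreGaloisCategory CategoryTheory.Limits
open scoped FintypeCatDiscrete

universe w u₂ u₁

variable {C : Type u₁} [Category.{u₂} C] [GaloisCategory C] (F : C ⥤ FintypeCat.{w}) [FiberFunctor F]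

/-! ### Equivariant fibre maps lift -/

/-- An `Aut F`-equivariant map of fibres is `F` of a morphism (fullness of `functorToAction`).
[cite: MochizukiGeoAn2004, §1.1 p.10] -/
theorem exists_hom_map_eq_of_equivariant {A B : C} (φ : F.obj A → F.obj B)
    (hφ : ∀ (σ : Aut F) (x : F.obj A), φ (σ • x) = σ • φ x) :
    ∃ f : A ⟶ B, ∀ x, F.map f x = φ x := by
  let g : (functorToAction F).obj A ⟶ (functorToAction F).obj B :=
    { hom := FintypeCat.homMk φ
      comm := fun σ => by
        ext x
        exact hφ σ x }
  obtain ⟨f, hf⟩ := (functorToAction F).map_surjective g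
  refine ⟨f, fun x => ?_⟩
  have h := congrArg (fun k => k.hom x) hf
  exact h

/-- `F` is faithful through `functorToAction`: morphisms with the same fibre maps are equal.
[cite: MochizukiGeoAn2004, §1.1 p.10] -/
theorem hom_ext_of_map_eq {A B : C} (f g : A ⟶ B) (h : ∀ x, F.map f x = F.map g x) : f = g := by
  apply (functorToAction F).map_injective
  ext x
  exact h x

/-! ### Automorphisms from equivariant permutations -/

/-- An `Aut F`-equivariant PERMUTATION of the fibre of `A` is `F` of an automorphism of `A`.
[cite: MochizukiGeoAn2004, §1.1 p.10] -/
theorem exists_aut_map_eq_of_equivariant_perm {A : C} (φ : F.obj A ≃ F.obj A)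
    (hφ : ∀ (σ : Aut F) (x : F.obj A), φ (σ • x) = σ • φ x) :
    ∃ f : Aut A, ∀ x, F.map f.hom x = φ x := by
  have hφ' : ∀ (σ : Aut F) (x : F.obj A), φ.symm (σ • x) = σ • φ.symm x := fun σ x => by
    apply φ.injective
    rw [hφ, φ.apply_symm_apply, φ.apply_symm_apply]
  obtain ⟨f, hf⟩ := exists_hom_map_eq_of_equivariant F φ hφ
  obtain ⟨g, hg⟩ := exists_hom_map_eq_of_equivariant F φ.symm hφ'
  refine ⟨⟨f, g, ?_, ?_⟩, hf⟩
  · apply hom_ext_of_map_eq F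
    intro x
    rw [F.map_comp, FintypeCat.comp_apply, hf, hg, F.map_id, FintypeCat.id_apply, φ.symm_apply_apply]
  · apply hom_ext_of_map_eq F
    intro x
    rw [F.map_comp, FintypeCat.comp_apply, hg, hf, F.map_id, FintypeCat.id_apply, φ.apply_symm_apply]

/-- **Galois from equivariant permutations**: if for all `x, y ∈ F(A)` some `Aut F`-equivariant
permutation of `F(A)` carries `x` to `y`, and `F(A)` is a nonempty transitive `Aut F`-set, then `A` is
Galois. [cite: MochizukiGeoAn2004, §1.1 p.10] -/
theorem isGalois_of_equivariant_perms {A : C} [Nonempty (F.obj A)]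
    [MulAction.IsPretransitive (Aut F) (F.obj A)]
    (h : ∀ x y : F.obj A, ∃ φ : F.obj A ≃ F.obj A,
      (∀ (σ : Aut F) (z : F.obj A), φ (σ • z) = σ • φ z) ∧ φ x = y) :
    IsGalois A := by
  haveI : IsConnected A := isConnected_of_isPretransitive F A
  rw [isGalois_iff_pretransitive F A]
  refine ⟨fun x y => ?_⟩
  obtain ⟨φ, hφ, hxy⟩ := h x y
  obtain ⟨f, hf⟩ := exists_aut_map_eq_of_equivariant_perm F φ hφ
  exact ⟨f, by change F.map f.hom x = y; rw [hf, hxy]⟩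

/-! ### Galois objects with prescribed open normal stabiliser -/

section Prescribed

variable (V : OpenSubgroup (Aut F))

omit [GaloisCategory C] [FiberFunctor F] in
/-- `Aut F ⧸ V` is finite for `V` open (compactness of `Aut F`). [cite: MochizukiGeoAn2004, §1.1 p.10] -/
theorem finite_quotient_openSubgroup : Finite (Aut F ⧸ V.toSubgroup) :=
  V.toSubgroup.quotient_finite_of_isOpen V.isOpen'

omit [GaloisCategory C] [FiberFunctor F] in
/-- In `Aut F ⧸ V`, `V` normal, the left action is left multiplication: `σ • q = σ̄ * q`.
[folklore] -/
private theorem smul_eq_mk_mul [V.toSubgroup.Normal] (σ : Aut F) (q : Aut F ⧸ V.toSubgroup) :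
    σ • q = (σ : Aut F ⧸ V.toSubgroup) * q := by
  obtain ⟨g, rfl⟩ := QuotientGroup.mk_surjective q
  rw [MulAction.Quotient.smul_mk, smul_eq_mul, QuotientGroup.mk_mul]

/-- **A Galois object with prescribed open normal stabiliser**: for `V ≤ Aut F` open and normal there
is a Galois object `A` of `C` with a point `a ∈ F(A)` whose stabiliser is `V` (so `F(A) ≅ Aut F ⧸ V`
equivariantly). [cite: MochizukiGeoAn2004, §1.1 p.10] -/
theorem exists_isGalois_stabilizer_eq [hV : V.toSubgroup.Normal] :
    ∃ (A : C) (_ : IsGalois A) (a : F.obj A), MulAction.stabilizer (Aut F) a = V.toSubgroup := by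
  classical
  haveI : Finite (Aut F ⧸ V.toSubgroup) := finite_quotient_openSubgroup F V
  -- shrink the finite `Aut F`-set `Q := Aut F ⧸ V` into the fibre universe
  let Q := Aut F ⧸ V.toSubgroup
  haveI hsmall : Small.{w} Q := Countable.toSmall Q
  let Y : Type w := @Shrink Q hsmall
  let eY : Q ≃ Y := @equivShrink Q hsmall
  letI : SMul (Aut F) Y := ⟨fun σ y => eY (σ • eY.symm y)⟩
  have smul_def : ∀ (σ : Aut F) (y : Y), σ • y = eY (σ • eY.symm y) := fun _ _ => rfl
  letI : MulAction (Aut F) Y :=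
    { one_smul := fun y => by rw [smul_def, one_smul, Equiv.apply_symm_apply]
      mul_smul := fun σ τ y => by rw [smul_def, smul_def, smul_def, Equiv.symm_apply_apply, mul_smul] }
  haveI : Finite Y := Finite.of_equiv Q eY
  have heY : ∀ (σ : Aut F) (q : Q), eY (σ • q) = σ • eY q := fun σ q => by
    rw [smul_def, Equiv.symm_apply_apply]
  -- stabilisers in `Y` are conjugates of `V`, i.e. `V`: open
  have hstabQ : ∀ g : Aut F, MulAction.stabilizer (Aut F) ((g : Aut F) : Q) = V.toSubgroup := by
    intro g
    ext σ
    rw [MulAction.mem_stabilizer_iff, MulAction.Quotient.smul_mk, smul_eq_mul, QuotientGroup.eq]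
    constructor
    · intro h
      have := hV.conj_mem _ h g
      rwa [show g * ((σ * g)⁻¹ * g) * g⁻¹ = σ⁻¹ by group, inv_mem_iff] at this
    · intro h
      have := hV.conj_mem _ (inv_mem h) g⁻¹
      rwa [inv_inv, show g⁻¹ * σ⁻¹ * g = (σ * g)⁻¹ * g by group] at this
  have hstabY : ∀ y : Y, MulAction.stabilizer (Aut F) y = V.toSubgroup := by
    intro y
    obtain ⟨q, rfl⟩ := eY.surjective y
    obtain ⟨g, rfl⟩ := QuotientGroup.mk_surjective q
    have h1 : MulAction.stabilizer (Aut F) (eY (g : Q)) = MulAction.stabilizer (Aut F) (g : Q) := by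
      ext σ
      simp only [MulAction.mem_stabilizer_iff, ← heY, eY.apply_eq_iff_eq]
    rw [h1]
    exact hstabQ g
  have hY : ∀ y : Y, IsOpen (MulAction.stabilizer (Aut F) y : Set (Aut F)) := fun y => by
    rw [hstabY y]
    exact V.isOpen'
  -- the object
  obtain ⟨A, e, he⟩ := exists_obj_of_aut_action F Y hY
  let a : F.obj A := e.symm (eY ((1 : Aut F) : Q))
  have hea : e a = eY ((1 : Aut F) : Q) := e.apply_symm_apply _
  have he' : ∀ (σ : Aut F) (x : F.obj A), e.symm (σ • e x) = σ • x := fun σ x => by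
    apply e.injective
    rw [he, e.apply_symm_apply]
  -- transitivity of `Aut F` on `F(A)`
  haveI : Nonempty (F.obj A) := ⟨a⟩
  haveI : MulAction.IsPretransitive (Aut F) (F.obj A) := ⟨fun x y => by
    obtain ⟨qx, hqx⟩ := eY.surjective (e x)
    obtain ⟨qy, hqy⟩ := eY.surjective (e y)
    obtain ⟨σ, hσ⟩ := MulAction.exists_smul_eq (Aut F) qx qy
    refine ⟨σ, e.injective ?_⟩
    rw [he, ← hqx, ← heY, hσ, hqy]⟩
  -- Galois: right translations of `Q` give equivariant permutations of `F(A)`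
  have hgal : IsGalois A := by
    refine isGalois_of_equivariant_perms F fun x y => ?_
    obtain ⟨qx, hqx⟩ := eY.surjective (e x)
    obtain ⟨qy, hqy⟩ := eY.surjective (e y)
    let c : Q := qx⁻¹ * qy
    let R : Q ≃ Q := ⟨fun q => q * c, fun q => q * c⁻¹, fun q => by simp, fun q => by simp⟩
    let φ : F.obj A ≃ F.obj A := e.trans (eY.symm.trans (R.trans (eY.trans e.symm)))
    refine ⟨φ, fun σ z => ?_, ?_⟩
    · change e.symm (eY (R (eY.symm (e (σ • z))))) = σ • e.symm (eY (R (eY.symm (e z))))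
      rw [he, ← he' σ, e.apply_symm_apply, smul_def σ (e z), eY.symm_apply_apply, ← heY]
      congr 2
      change (σ • eY.symm (e z)) * c = σ • (eY.symm (e z) * c)
      rw [smul_eq_mk_mul F V, smul_eq_mk_mul F V, mul_assoc]
    · change e.symm (eY (R (eY.symm (e x)))) = y
      apply e.injective
      rw [e.apply_symm_apply, ← hqx, eY.symm_apply_apply, ← hqy]
      change eY (qx * (qx⁻¹ * qy)) = eY qy
      rw [mul_inv_cancel_left]
  refine ⟨A, hgal, a, ?_⟩
  -- the stabiliser of `a`
  ext σ
  rw [MulAction.mem_stabilizer_iff, ← hstabY (eY ((1 : Aut F) : Q)), MulAction.mem_stabilizer_iff,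
    ← hea, ← he]
  exact e.apply_eq_iff_eq.symm.trans (by rw [hea])

end Prescribed

/-! ### Morphisms from stabiliser inclusions -/

/-- **A morphism `A ⟶ B` with `a ↦ b` from `Stab(a) ≤ Stab(b)`**, `A` connected (so `Aut F` is transitive
on `F(A)`): the equivariant map `σ • a ↦ σ • b`, lifted by fullness. [cite: MochizukiGeoAn2004, §1.1 p.10] -/
theorem exists_hom_of_stabilizer_le {A B : C} [IsConnected A] (a : F.obj A) (b : F.obj B)
    (h : MulAction.stabilizer (Aut F) a ≤ MulAction.stabilizer (Aut F) b) :
    ∃ f : A ⟶ B, F.map f a = b := by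
  classical
  -- choose, for each `x`, some `σ` with `σ • a = x`
  have hsurj : ∀ x : F.obj A, ∃ σ : Aut F, σ • a = x := fun x => MulAction.exists_smul_eq (Aut F) a x
  choose s hs using hsurj
  let φ : F.obj A → F.obj B := fun x => s x • b
  have hwd : ∀ (σ : Aut F) (x : F.obj A), σ • a = x → σ • b = φ x := by
    intro σ x hx
    have h1 : (s x)⁻¹ * σ ∈ MulAction.stabilizer (Aut F) a := by
      rw [MulAction.mem_stabilizer_iff, mul_smul, hx, inv_smul_eq_iff]
      exact (hs x).symm
    have h2 := h h1
    rw [MulAction.mem_stabilizer_iff, mul_smul, inv_smul_eq_iff] at h2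
    exact h2
  have hφ : ∀ (σ : Aut F) (x : F.obj A), φ (σ • x) = σ • φ x := by
    intro σ x
    rw [← hwd (σ * s x) (σ • x) (by rw [mul_smul, hs])]
    change (σ * s x) • b = σ • s x • b
    rw [mul_smul]
  obtain ⟨f, hf⟩ := exists_hom_map_eq_of_equivariant F φ hφ
  refine ⟨f, ?_⟩
  rw [hf, ← hwd 1 a (one_smul _ _), one_smul]

end Literature.AnabelianGeometry.Anabelioids
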